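import Literature.AlgebraicGeometry.Frobenioids.PerfectionPreFrobenioid
import Literature.AlgebraicGeometry.Frobenioids.PerfectionIsotropicClauses
import Literature.AlgebraicGeometry.Frobenioids.PerfectionBaseSurjective
import Literature.AlgebraicGeometry.Frobenioids.PerfectionCoAngularPreStepsBase
import Literature.AlgebraicGeometry.Frobenioids.PerfectionCoAngularDivisorsOver
import Literature.AlgebraicGeometry.Frobenioids.PerfectionFactorization
import Literature.AlgebraicGeometry.Frobenioids.PerfectionFactorizationUnique
import Literature.AlgebraicGeometry.Frobenioids.PerfectionUnits
import HarnessLib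

/-!
# Frobenioids I, Proposition 3.2 (iii): **`C^pf` is a Frobenioid** — the assembly of Definition 1.3 for THE
# perfection of a Frobenioid of Frobenius-isotropic type (PROOFS)

Mochizuki, *The geometry of Frobenioids I: the general theory*, Kyushu J. Math. **62** (2008)
293–400, Definition 1.3 pp. 24–25, Definition 3.1 (iii) p. 57, Proposition 3.2 (iii) p. 59
[cite: MochizukiFrdI2008, Prop. 3.2 (iii) p.59]: "`C^pf`, equipped with the functor `C^pf → F_{Φ^pf}` of (i),
is a Frobenioid of perfect and isotropic type", under the standing hypothesis of §3 (Def. 3.1 (iii), p. 56):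
"Suppose that the Frobenioid `C` is of Frobenius-isotropic type."

This file assembles `IsFrobenioid (Perfection.ops hF).toFunctor` (the 26-field structure of `Frobenioid.lean`,
seat abc-iut-found) for THE perfection `Perfection hF` (seat abc-iut-L1-d9) with its structure functor
`C^pf → F_{Φ^pf}` (`PreFrobenioidDataToFunctor.lean`, seat abc-iut-L1-d1), from the clause files of the
abc-iut row `FrdI:Prop3.2(iii)-frobenioid` (carve-up v2, L1-lead R99 (2)):

* `isPreFrobenioid` — `PerfectionPreFrobenioid.lean` (abc-iut-L1-d9);
* (i)(a)(b)(c) — `PerfectionBaseSurjective.lean` (abc-iut-L1-d9);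
* (ii) — `PerfectionFrobeniusArrows.lean` (`ii_exists_perfection`, `ii_unique_perfection`; abc-iut-L1-d1);
* (iii)(a)(b)(c), (c-base), (d) ×4 — `PerfectionCoAngularPreSteps(Base).lean`, `PerfectionCoAngularDivisors(Over).lean`
  (abc-iut-w5-d246);
* (iv)(a) existence, (iv)(b) — `PerfectionFactorization.lean`; (iv)(a) uniqueness —
  `PerfectionFactorizationUnique.lean` (formal in `C^pf`; abc-iut-w5-d246);
* (v)(a) — `PerfectionPreSteps.lean` (`mono_of_isPreStep`; abc-iut-L1-d9); (v)(b)(c), (vii)(a)(b) —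
  `PerfectionIsotropicClauses.lean` (abc-iut-L1-d9); (vi) — `PerfectionUnits.lean` (abc-iut-w5-d246).

The data-level clauses (over the operations `Perfection.ops hF`) are turned into the functor-level fields
through the dictionary `PreFrobenioidData.ofFunctor_isX` (`PreFrobenioidDataOfFunctor.lean`, seat
abc-iut-L1-t3) and `PreFrobenioidData.ofFunctor_toFunctor : ofFunctor S.monFunctor S.toFunctor = S` (`rfl`).
No new definitions; nothing here is specific to the abc programme.
-/

namespace Literature.AlgebraicGeometry.Frobenioids

namespace PreFrobenioid

namespace Perfection

open CategoryTheory Opposite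

universe w v v' u u'

variable {D : Type u} [Category.{v} D] {Φ : Dᵒᵖ ⥤ CommMonCat.{w}}
  {C : Type u'} [Category.{v'} C] {F : C ⥤ ElemFrobenioid Φ} {hF : IsFrobenioid F}

/-! ### The dictionary between the structure functor `C^pf → F_{Φ^pf}` and the operations `Perfection.ops` -/

/-- Co-angular pre-steps: functor-level to data-level. [cite: MochizukiFrdI2008, Def. 1.2 (iii) p.22] -/
theorem isCoAngularPreStep_ops_of {X Y : Perfection hF} {φ : X ⟶ Y}
    (h : PreFrobenioid.IsCoAngularPreStep (ops hF).toFunctor φ) : (ops hF).IsCoAngularPreStep φ :=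
  ⟨(PreFrobenioidData.ofFunctor_isCoAngular (ops hF).toFunctor φ).mpr h.1, h.2⟩

/-- Co-angular pre-steps: data-level to functor-level. [cite: MochizukiFrdI2008, Def. 1.2 (iii) p.22] -/
theorem isCoAngularPreStep_toFunctor_of {X Y : Perfection hF} {φ : X ⟶ Y}
    (h : (ops hF).IsCoAngularPreStep φ) : PreFrobenioid.IsCoAngularPreStep (ops hF).toFunctor φ :=
  ⟨(PreFrobenioidData.ofFunctor_isCoAngular (ops hF).toFunctor φ).mp h.1, h.2⟩

/-- Arrows of Frobenius type: functor-level to data-level. [cite: MochizukiFrdI2008, Def. 1.2 (iii) p.22] -/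
theorem isFrobeniusType_ops_of {X Y : Perfection hF} {φ : X ⟶ Y}
    (h : PreFrobenioid.IsFrobeniusType (ops hF).toFunctor φ) : (ops hF).IsFrobeniusType φ :=
  (PreFrobenioidData.isFrobeniusType_toFunctor_iff (ops hF) φ).mp h

/-- Arrows of Frobenius type: data-level to functor-level. [cite: MochizukiFrdI2008, Def. 1.2 (iii) p.22] -/
theorem isFrobeniusType_toFunctor_of {X Y : Perfection hF} {φ : X ⟶ Y}
    (h : (ops hF).IsFrobeniusType φ) : PreFrobenioid.IsFrobeniusType (ops hF).toFunctor φ :=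
  (PreFrobenioidData.isFrobeniusType_toFunctor_iff (ops hF) φ).mpr h

/-- Pull-back morphisms: functor-level to data-level. [cite: MochizukiFrdI2008, Def. 1.2 (ii) p.21] -/
theorem isPullbackMorphism_ops_of {X Y : Perfection hF} {φ : X ⟶ Y}
    (h : PreFrobenioid.IsPullbackMorphism (ops hF).toFunctor φ) : (ops hF).IsPullbackMorphism φ :=
  (PreFrobenioidData.ofFunctor_isPullbackMorphism (ops hF).toFunctor φ).mpr h

/-- Pull-back morphisms: data-level to functor-level. [cite: MochizukiFrdI2008, Def. 1.2 (ii) p.21] -/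
theorem isPullbackMorphism_toFunctor_of {X Y : Perfection hF} {φ : X ⟶ Y}
    (h : (ops hF).IsPullbackMorphism φ) : PreFrobenioid.IsPullbackMorphism (ops hF).toFunctor φ :=
  (PreFrobenioidData.ofFunctor_isPullbackMorphism (ops hF).toFunctor φ).mp h

/-! ### The assembly -/

variable (hF) in
/-- **Proposition 3.2 (iii): `C^pf` is a Frobenioid.**  For a Frobenioid `C → F_Φ` of Frobenius-isotropic type
(the standing hypothesis of §3), THE perfection `C^pf = Perfection hF`, equipped with its structure functor
`C^pf → F_{Φ^pf}` of Prop. 3.2 (i) (`(Perfection.ops hF).toFunctor`), satisfies Definition 1.3 (i)–(vii).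
[cite: MochizukiFrdI2008, Prop. 3.2 (iii) p.59] -/
theorem isFrobenioid (hiso : IsOfType (IsFrobeniusIsotropic F)) : IsFrobenioid (ops hF).toFunctor where
  isPreFrobenioid := isPreFrobenioid_perfection hF
  i_a A₀ := by
    obtain ⟨X, hX, hi⟩ := i_a_perfection hF A₀
    exact ⟨X, (PreFrobenioidData.ofFunctor_isFrobeniusTrivial (ops hF).toFunctor X).mp hX, hi⟩
  i_b X Y α := i_b_perfection hF X Y α
  i_c := i_c_perfection hF
  ii_exists X n := by
    obtain ⟨Y, φ, hφ, hn⟩ := ii_exists_perfection hF X n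
    exact ⟨Y, φ, isFrobeniusType_toFunctor_of hφ, hn⟩
  ii_unique X Y Y' φ ψ hφ hψ hd :=
    ii_unique_perfection hF hiso φ ψ (isFrobeniusType_ops_of hφ) (isFrobeniusType_ops_of hψ) hd
  iii_a X Y Z f g _ _ :=
    (PreFrobenioidData.ofFunctor_isCoAngular (ops hF).toFunctor _).mp (isCoAngular_of_frobeniusIsotropic hiso _)
  iii_b X' X φ _ ψ :=
    (PreFrobenioidData.ofFunctor_isCoAngular (ops hF).toFunctor _).mp (isCoAngular_of_frobeniusIsotropic hiso ψ)
  iii_c X Y φ hφ := iii_c_perfection hiso φ (isCoAngularPreStep_ops_of hφ)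
  iii_c_base X Y φ φ' hφ hφ' hb α β β' h h' :=
    iii_c_base_perfection hiso φ φ' (isCoAngularPreStep_ops_of hφ) (isCoAngularPreStep_ops_of hφ') hb α β β' h h'
  iii_d_under_full X Y Y' φ φ' hφ hφ' hdvd := by
    obtain ⟨f, hf, e⟩ := iii_d_under_full_perfection hiso φ φ' (isCoAngularPreStep_ops_of hφ)
      (isCoAngularPreStep_ops_of hφ') hdvd
    exact ⟨f, isCoAngularPreStep_toFunctor_of hf, e⟩
  iii_d_under_surj X x := by
    obtain ⟨Y, φ, hφ, e⟩ := iii_d_under_surj_perfection hiso X x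
    exact ⟨Y, φ, isCoAngularPreStep_toFunctor_of hφ, e⟩
  iii_d_over_full X Y Y' ψ ψ' hψ hψ' hdvd := iii_d_over_full_perfection hiso ψ ψ' hψ hψ' hdvd
  iii_d_over_surj X x := iii_d_over_surj_perfection hiso X x
  iv_a_exists X Y φ := by
    obtain ⟨P, Q, γ, β, α, e, hγ, hβ, hα⟩ := iv_a_exists_perfection (hF := hF) φ
    exact ⟨P, Q, γ, β, α, e, isFrobeniusType_toFunctor_of hγ, hβ, isPullbackMorphism_toFunctor_of hα⟩
  iv_a_unique A B X Y X' Y' φ γ β α γ' β' α' h hγ hβ hα h' hγ' hβ' hα' :=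
    iv_a_unique_perfection hiso φ γ β α γ' β' α' h (isFrobeniusType_ops_of hγ) hβ (isPullbackMorphism_ops_of hα)
      h' (isFrobeniusType_ops_of hγ') hβ' (isPullbackMorphism_ops_of hα')
  iv_b X Y φ hφ := by
    obtain ⟨h₁, h₂⟩ := iv_b_perfection hiso φ (isPullbackMorphism_ops_of hφ)
    exact ⟨(PreFrobenioidData.ofFunctor_isLBInvertible (ops hF).toFunctor φ).mp h₁, h₂⟩
  v_a X Y φ hφ := mono_of_isPreStep hφ
  v_b_exists X Y φ hφ := by
    obtain ⟨Z, β, α, e, hβ, hα⟩ := v_b_exists_perfection hiso φ hφ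
    exact ⟨Z, β, α, e, isCoAngularPreStep_toFunctor_of hβ, hα⟩
  v_b_unique X Y Z Z' φ β α β' α' h hβ hα h' hβ' hα' :=
    v_b_unique_perfection hiso φ β α β' α' h (isCoAngularPreStep_ops_of hβ) hα h'
      (isCoAngularPreStep_ops_of hβ') hα'
  v_c_exists X Y φ hφ := by
    obtain ⟨Z, β, α, e, hβ, hα⟩ := v_c_exists_perfection hiso φ hφ
    exact ⟨Z, β, α, e, hβ, isCoAngularPreStep_toFunctor_of hα⟩
  v_c_unique X Y Z Z' φ β α β' α' h hβ hα h' hβ' hα' :=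
    v_c_unique_perfection hiso φ β α β' α' h hβ (isCoAngularPreStep_ops_of hα) h' hβ'
      (isCoAngularPreStep_ops_of hα')
  vi X Y φ ψ hφ hψ hb hm :=
    vi_perfection hiso φ ψ (isCoAngularPreStep_ops_of hφ) (isCoAngularPreStep_ops_of hψ) hb hm
  vii_a := vii_a_perfection hiso
  vii_b X Y _ _ := isIsotropic_toFunctor hiso Y

variable (hF) in
/-- **Proposition 3.2 (iii)** in the language of the cell's interface: THE perfection datum
`PreFrobenioidData.perfection hF` of a Frobenioid of Frobenius-isotropic type has a Frobenioid structure functor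
`P.ops.toFunctor`. [cite: MochizukiFrdI2008, Prop. 3.2 (iii) p.59] -/
theorem isFrobenioid_perfectionData (hiso : IsOfType (IsFrobeniusIsotropic F)) :
    IsFrobenioid (PreFrobenioidData.perfection hF).ops.toFunctor :=
  isFrobenioid hF hiso

end Perfection

end PreFrobenioid

end Literature.AlgebraicGeometry.Frobenioids
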